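import Summits.Ventures.HodgeRepro2.T5CMCensusPackage

/-!
# T5ResidueCardAbsNorm — `q_v = N(v)`: the size of the local residue field is the absolute norm of
# the place, and the local conjugation at an inert place is `y ↦ y^{N(v)}` on the residue field

Tier-5 kernel support (seat p8, blind lane; sub-step N3).  T5-170 / T5-179 state the Frobenius
reduction with `q_v = Fintype.card (𝓀_v)` for `𝓀_v` the residue field of Mathlib's completion
`O_{K_v}`.  The identification `q_v = N(v) = |𝓞_K ⧸ v|` (Mathlib's `Ideal.absNorm`) is p4's
`T5AdicCompletionResidueField.card_residueField` (REUSED by import — v2 of this file: v1 had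
restated it as `natCard_residueField_eq_absNorm`; per the tree's append-only rule that lemma and
`natCard_residueField_eq_natCard_quotient` are kept, DEPRECATED in favour of p4's declarations, and
now proved from them); this file transports `q_v = N(v)` to `Fintype.card` and restates the
Frobenius reduction with `N(v)` as the exponent.

No `sorry`, no axiom beyond `propext`, `Classical.choice`, `Quot.sound`.
-/

namespace Summit.Ventures.HodgeRepro2.T5ResidueCardAbsNorm

open NumberField IsDedekindDomain HeightOneSpectrum

variable {K : Type*} [Field K] [NumberField K] (v : HeightOneSpectrum (𝓞 K))

/-- `|𝓀_v| = |𝓞_K ⧸ v|` — p4's `quotientEquivResidueField`; DEPRECATED (v2): use p4's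
`T5AdicCompletionResidueField.quotientEquivResidueField` directly. -/
@[deprecated T5AdicCompletionResidueField.quotientEquivResidueField (since := "2026-08-26")]
theorem natCard_residueField_eq_natCard_quotient :
    Nat.card (IsLocalRing.ResidueField (v.adicCompletionIntegers K)) = Nat.card (𝓞 K ⧸ v.asIdeal) :=
  (Nat.card_congr (T5AdicCompletionResidueField.quotientEquivResidueField v).toEquiv).symm

/-- `q_v = N(v)` — a restatement of p4's `T5AdicCompletionResidueField.card_residueField`;
DEPRECATED (v2): use p4's declaration. -/
@[deprecated T5AdicCompletionResidueField.card_residueField (since := "2026-08-26")]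
theorem natCard_residueField_eq_absNorm :
    Nat.card (IsLocalRing.ResidueField (v.adicCompletionIntegers K)) = Ideal.absNorm v.asIdeal :=
  T5AdicCompletionResidueField.card_residueField v

/-- `q_v = N(v)` with `Fintype.card` (any `Fintype` structure on `𝓀_v`): p4's
`T5AdicCompletionResidueField.card_residueField` (`Nat.card 𝓀_v = absNorm v`), transported. -/
theorem card_residueField_eq_absNorm [Fintype (IsLocalRing.ResidueField (v.adicCompletionIntegers K))] :
    Fintype.card (IsLocalRing.ResidueField (v.adicCompletionIntegers K)) = Ideal.absNorm v.asIdeal := by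
  rw [Fintype.card_eq_nat_card, T5AdicCompletionResidueField.card_residueField]

/-- **The local conjugation at an inert place is `y ↦ y^{N(v)}` on the residue field** (T5-170 with
`q_v = N(v)`): for `e(w/v) = 1`, `f(w/v) = 2` and `σ ≠ 1` in `Gal(L_w/K_v)`,
`σ y ≡ y^{N(v)} (mod 𝔪_w)` for every `y ∈ O_{L_w}`. -/
theorem residue_galRestrict_eq_pow_absNorm {L : Type*} [Field L] [NumberField L] [Algebra K L]
    (w : HeightOneSpectrum (𝓞 L)) [w.asIdeal.LiesOver v.asIdeal]
    (he : v.asIdeal.ramificationIdx' w.asIdeal = 1) (hf : v.asIdeal.inertiaDeg' w.asIdeal = 2)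
    (σ : Gal(w.adicCompletion L/v.adicCompletion K)) (hσ : σ ≠ 1) (y : w.adicCompletionIntegers L) :
    IsLocalRing.residue (w.adicCompletionIntegers L)
        (galRestrict (v.adicCompletionIntegers K) (v.adicCompletion K) (w.adicCompletion L)
          (w.adicCompletionIntegers L) σ y) =
      IsLocalRing.residue (w.adicCompletionIntegers L) y ^ Ideal.absNorm v.asIdeal := by
  letI := Fintype.ofFinite (IsLocalRing.ResidueField (v.adicCompletionIntegers K))
  rw [← card_residueField_eq_absNorm v]
  exact T5InertPlaceFrobenius.residue_galRestrict_eq_pow v w he hf σ hσ y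

/-- The CM form (T5-179's setting): at every `v` of `E⁺` with `4d ∉ v` and `(d / v) = −1`, the
local conjugation of `E_w/E⁺_v` reduces to `y ↦ y^{N(v)}`. -/
theorem cm_residue_galRestrict_eq_pow_absNorm (E : Type*) [Field E] [NumberField E] [IsCMField E]
    {x : 𝓞 E} {d : 𝓞 (maximalRealSubfield E)} (v : HeightOneSpectrum (𝓞 (maximalRealSubfield E)))
    (hx : x * x = algebraMap (𝓞 (maximalRealSubfield E)) (𝓞 E) d)
    (hx' : x ∉ Set.range (algebraMap (𝓞 (maximalRealSubfield E)) (𝓞 E)))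
    (hv : 4 * d ∉ v.asIdeal) (hd : ¬ IsSquare (Ideal.Quotient.mk v.asIdeal d))
    (w : HeightOneSpectrum (𝓞 E)) [w.asIdeal.LiesOver v.asIdeal]
    (σ : Gal(w.adicCompletion E/v.adicCompletion (maximalRealSubfield E))) (hσ : σ ≠ 1)
    (y : w.adicCompletionIntegers E) :
    IsLocalRing.residue (w.adicCompletionIntegers E)
        (galRestrict (v.adicCompletionIntegers (maximalRealSubfield E))
          (v.adicCompletion (maximalRealSubfield E)) (w.adicCompletion E)
          (w.adicCompletionIntegers E) σ y) =
      IsLocalRing.residue (w.adicCompletionIntegers E) y ^ Ideal.absNorm v.asIdeal :=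
  residue_galRestrict_eq_pow_absNorm v w (T5CMCensusPackage.ramificationIdx'_eq_one E v hx hx' hv hd w)
    (T5CMCensusPackage.inertiaDeg'_eq_two E v hx hx' hv hd w) σ hσ y

end Summit.Ventures.HodgeRepro2.T5ResidueCardAbsNorm
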